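import Summits.QuantumFields.BalabanUV.Beta.GAN24.WSlotOfShapes
import Summits.QuantumFields.BalabanUV.Beta.GAN24.StencilSlotSAllThree
import Summits.QuantumFields.BalabanUV.Beta.GAN24.TaylorRowDWThree
import Summits.QuantumFields.BalabanUV.Beta.GAN24.S3DiffV
import Summits.QuantumFields.BalabanUV.Beta.GAN24.S3DiffL

/-!
# `BalabanUV.Beta.GAN24.SpureUnitDrift` — binder row G-an2-4 / (CONV-C), the W-slot's CAUCHY half `hWall`: ITS S-ARGUMENT DATUM — the geometric
# DRIFT of an2's normalised first FIELD table `Spure` along the tower (generic `d` from «E3Shape» ∧ «E3Drift»; `d = 3`, `Lc ≥ 2` UNCONDITIONAL)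

NOT IN PRINT; OUR PROOF ATTEMPT (G-an2-4 formalisation swarm, leaf prover 10, gen 15; an idle seat's kernel reduction — NOT a `LEAVES.md` row).
HONEST FRAMING (cell contract, verbatim): «discharging `BetaPertH` makes Bałaban's UV stability UNCONDITIONAL — a real constructive-QFT result;
it is NOT the continuum limit and NOT the Clay problem.»  HONEST DEPENDENCY (verbatim): «continuum YM on T⁴ ⇐ BetaPertH ∧ nine spine estimates
(0/9 proved); BetaPertH ⇐ (D1) ∧ (D4) ∧ CAP+tail; G-an2-4 gates asym, D1 and NE2/3/4.»

ABSOLUTE RULE (cell, verbatim): «No internally-minted statement may enter as a cited fact. Every hypothesis is either kernel-proved in this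
package or a verbatim quotation of a PUBLISHED theorem with page reference. The manuscript(s) under audit are NOT citable for their own disputed
steps — they are the thing under adjudication; programme-internal (2001/route/tribunal) claims are never citable.»  Every theorem below is
[folklore] bookkeeping proved from the imports; 0 `def`, 0 `[cite:]`, 0 `def … : Prop`; the located shapes «E3Shape» ∕ «E3Drift» enter §1 as
INLINE HYPOTHESES and are supplied at `d = 3` in §2 by the swarm's twelve landed rows BY NAME.

WHY.  After the K-slot (`KSlotAssembly.convCKWall_holds`) and the S-slot (`StencilSlotSThree.hS_three`, `StencilSlotSAllThree`) the remaining
analytic binder pair of asym1's wall `HessKerDressedUnitsWall.d1Drift_JsBalOf_iff_of_cauchy_unit` ∕ `StencilSlotWallThree.d1Drift_JsBalOf_iff_three_of_diffRows`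
is an2's W-pair `(hW, hWall)` for the family `W := BalabanStepW2.WbalOf d Lc cE cVH cΛ T₂ mixFF`.  By an4's `SecondOrderUnits.unitW_WbalOf` the
dressed member `j` IS `W2SymOfK (unitK K_j) Lc (unitS (Spure j)) (unitM (M1 j)) (unitS₂ (T₂ j)) (unitM₂ (M2Of mixFF j))`; leaf-07's
`WSlotOfShapes.hW_of_shapes` gives the UNIFORM half from the five arguments' uniform shapes, and the CAUCHY half `hWall` needs, besides a Lipschitz
form of `W2SymOfK` (leaf-03, «W2-LIPSCHITZ*»), the five arguments' DRIFT data: K = the K-slot's `CauchyDecayK` (tree), M and M₂ are `j`-FREE after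
normalisation (`WSlotOfShapes.unitM_M1_eq` ∕ `unitM₂_M2Of_eq`: drift `0`), S₂ = the located «T2Drift» — and S = `Spure`, THIS FILE.

## What is proved
* §1 (generic `d`, `NeZero Lc`, `1 ≤ Lc`; NO K-slot hypothesis — `Spure` has no Lagrange piece):
  `locStencil_unitS_Spure_succ_sub` — «E3Drift» `∀ k j, LocStencil (Ẽ(k+j+1) − Ẽ(k+1)) (c₃·θ^k) δ₃` ⟹ for all `k j`,
  `LocStencil (unitS_{k+j+1} (Spure (k+j+1)) − unitS_{k+1} (Spure (k+1))) (c₃·θ^k) δ₃` with the SAME constant (the (V-H) summand has drift `0`: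
  gan24-p1's `StencilSlotVH.unitS_vhPiece_eq`); **`spureDrift_of_shapes`** — «E3Shape» ∧ «E3Drift» ∧ `0 < θ` ⟹
  `∃ cS δS, 0 < δS ∧ ∀ k j, LocStencil (unitS_{k+j} (Spure (k+j)) − unitS_k (Spure k)) (cS·θ^k) δS` (pairs with `k = 0` through leaf-07's uniform
  `WSlotOfShapes.locStencil_unitS_Spure`, pairs with `k ≥ 1` through `θ^{k−1} = θ⁻¹θ^k`; the template of gan24-p1's
  `StencilSlotCauchyOfShapes.hSall_of_shapes` without its Λ summand).
* §2 (`d = 3`, `Lc ≥ 2`): **`e3ShapeDrift_three`** — «E3Shape» ∧ «E3Drift» with rate data `0 < θ₃ < 1`, `0 < δ₃`, UNCONDITIONAL: the twelve landed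
  rows of road «S3» BY NAME (`TaylorRowW.rowW_three`, `S3RowV0.shapeV0`, `S3ShapeL0.rowL0_shape`, `S3ShapeVt.shapeVt_three`, `TaylorRowLamTop.rowLamTop`,
  `TaylorRowV.rowV_three`, `TaylorRowLam.rowL_three`, `TaylorRowDWThree.rowDW_three`, `TopBorderKSlot.diffVt_three`, `S3DiffLt.diffLt_three`,
  `S3DiffV.diffV_three`, `S3DiffL.diffL_three`) → `StencilSlotRowsMerge.rows_merge` → `StencilSlotE3Tables.e3Shape_and_drift_of_rows` (the
  composition performed inside `StencilSlotWallThree.d1Drift_JsBalOf_iff_three_of_diffRows`, exposed as a standalone ∃-statement for the W-slot's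
  consumers); **`spureShapeDrift_three`** ∕ **`spureDrift_three`** — the normalised `Spure` family at `d = 3` is uniformly local AND Cauchy at a
  geometric rate `θ ∈ (0,1)`, UNCONDITIONAL.

HONEST: the S-argument datum of the W-slot's Cauchy half only; discharges NOTHING of `(hW, hWall)` by itself (the Lipschitz engine, «T2Shape»,
«T2Drift» and the mixed table's shape are not here); 0 wall binders instantiated; NOT «W-slot closed», NEVER «G-an2-4 closed»; NOT BetaPertH,
NOT continuum, NOT Clay.
-/

noncomputable section

open Literature.MathematicalPhysics.QuantumFieldTheory
open Literature.MathematicalPhysics.QuantumFieldTheory.Balaban1983to89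
open Literature.MathematicalPhysics.QuantumFieldTheory.Balaban1983to89.Beta
open ExpKernelCalculus (MKer)
open OneStepResolventKernel (Fib LocStencil)
open BalabanStepJetsSucc (wE e3Of)
open BalabanStepW2 (Spure)
open Summit.QuantumFields.BalabanUV.Beta.HessKerDressedUnits (unitS)
open Summit.QuantumFields.BalabanUV.Beta.GAN24.CombesThomas (sfStep smStep)
open Summit.QuantumFields.BalabanUV.Beta.GAN24.StencilSlotVH (unitS_vhPiece_eq)
open Summit.QuantumFields.BalabanUV.Beta.GAN24.StencilSlotOfShapes (locStencil_mono')
open Summit.QuantumFields.BalabanUV.Beta.GAN24.StencilSlotCauchyOfShapes (locStencil_sub)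
open Summit.QuantumFields.BalabanUV.Beta.GAN24.StencilSlotOfE3 (one_le_of_two_le)
open Summit.QuantumFields.BalabanUV.Beta.GAN24.StencilSlotSThree (inv_Lc_ratio)
open Summit.QuantumFields.BalabanUV.Beta.GAN24.StencilSlotRowsMerge (rows_merge)
open Summit.QuantumFields.BalabanUV.Beta.GAN24.StencilSlotE3Tables (e3Shape_and_drift_of_rows)
open Summit.QuantumFields.BalabanUV.Beta.GAN24.WSlotOfShapes (unitS_Spure_succ_eq locStencil_unitS_Spure)

namespace Summit.QuantumFields.BalabanUV.Beta.GAN24.SpureUnitDrift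

variable {d : ℕ}

/-! ## §1 Generic `d`: the drift of the normalised `Spure` family from «E3Shape» ∧ «E3Drift» -/

section Generic

variable {Lc : ℕ} [NeZero Lc]

/-- [folklore] **MEMBERS `≥ 1`: THE DRIFT OF THE NORMALISED `Spure` IS THE DRIFT OF ITS THIRD-JET SUMMAND** — for all `k j`, the normalised
members `k+j+1` and `k+1` differ by a local family with EXACTLY the constant `c₃·θ^k` and rate `δ₃` of «E3Drift»: the (V-H) summand is `j`-free
after normalisation (`StencilSlotVH.unitS_vhPiece_eq`) and cancels.  No K-slot hypothesis. -/
theorem locStencil_unitS_Spure_succ_sub {cE cVH cΛ c₃ θ δ₃ : ℝ}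
    (hE3d : ∀ k j : ℕ, LocStencil (fun κ u =>
        unitS (sfStep Lc (k + j + 1)) (smStep d Lc (k + j + 1))
            (fun κ u => (cE * wE d Lc (k + j + 1)) • e3Of d Lc cE cVH cΛ (k + j + 1) κ u) κ u -
          unitS (sfStep Lc (k + 1)) (smStep d Lc (k + 1))
            (fun κ u => (cE * wE d Lc (k + 1)) • e3Of d Lc cE cVH cΛ (k + 1) κ u) κ u) (c₃ * θ ^ k) δ₃)
    (k j : ℕ) :
    LocStencil (unitS (sfStep Lc (k + j + 1)) (smStep d Lc (k + j + 1)) (Spure d Lc cE cVH cΛ (k + j + 1)) -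
        unitS (sfStep Lc (k + 1)) (smStep d Lc (k + 1)) (Spure d Lc cE cVH cΛ (k + 1))) (c₃ * θ ^ k) δ₃ := by
  intro κ u x y a b
  have h1 := (hE3d k j) κ u x y a b
  simp only [Pi.sub_apply] at h1 ⊢
  rw [unitS_Spure_succ_eq, unitS_Spure_succ_eq]
  simp only [Pi.add_apply]
  rw [unitS_vhPiece_eq, unitS_vhPiece_eq]
  -- entries: (E₁ + V) − (E₂ + V) = E₁ − E₂
  have halg : ∀ e₁ v e₂ : ℝ, e₁ + v - (e₂ + v) = e₁ - e₂ := fun _ _ _ => by ring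
  rw [halg]
  exact h1

/-- [folklore] **THE DRIFT OF THE WHOLE NORMALISED `Spure` FAMILY FROM THE TWO LOCATED SHAPES**: from «E3Shape» (`hE3`, `0 < δ₃`), «E3Drift»
(`hE3d`) and `0 < θ`: `∃ cS δS, 0 < δS ∧ ∀ k j, LocStencil (unitS_{k+j} (Spure (k+j)) − unitS_k (Spure k)) (cS·θ^k) δS` — the `S`-argument
deviation datum that a Lipschitz form of `W2SymOfK` consumes for the wall's `hWall` at `W := WbalOf …` (pairs with `k = 0` through the uniform
bound `2Cs = 2Cs·θ⁰` of `WSlotOfShapes.locStencil_unitS_Spure`; pairs with `k ≥ 1` through `locStencil_unitS_Spure_succ_sub` and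
`θ^{k−1} = θ⁻¹·θ^k`). -/
theorem spureDrift_of_shapes (hLc : 1 ≤ Lc) {θ : ℝ} (hθ : 0 < θ) {cE cVH cΛ C₃ c₃ δ₃ : ℝ}
    (hE3 : ∀ j : ℕ, LocStencil (unitS (sfStep Lc (j + 1)) (smStep d Lc (j + 1))
      (fun κ u => (cE * wE d Lc (j + 1)) • e3Of d Lc cE cVH cΛ (j + 1) κ u)) C₃ δ₃)
    (hE3d : ∀ k j : ℕ, LocStencil (fun κ u =>
        unitS (sfStep Lc (k + j + 1)) (smStep d Lc (k + j + 1))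
            (fun κ u => (cE * wE d Lc (k + j + 1)) • e3Of d Lc cE cVH cΛ (k + j + 1) κ u) κ u -
          unitS (sfStep Lc (k + 1)) (smStep d Lc (k + 1))
            (fun κ u => (cE * wE d Lc (k + 1)) • e3Of d Lc cE cVH cΛ (k + 1) κ u) κ u) (c₃ * θ ^ k) δ₃)
    (hδ₃ : 0 < δ₃) :
    ∃ cS δS : ℝ, 0 < δS ∧ ∀ k j, LocStencil
      (unitS (sfStep Lc (k + j)) (smStep d Lc (k + j)) (Spure d Lc cE cVH cΛ (k + j)) -
        unitS (sfStep Lc k) (smStep d Lc k) (Spure d Lc cE cVH cΛ k)) (cS * θ ^ k) δS := by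
  obtain ⟨Cs, δ₀, hδ₀, hS⟩ := locStencil_unitS_Spure (d := d) (Lc := Lc) hLc hE3 hδ₃
  have hc₃ : 0 ≤ c₃ := by
    have h := ((locStencil_unitS_Spure_succ_sub (d := d) (Lc := Lc) hE3d 0 0) 0 0).nonneg (Sum.inl 0)
    simpa using h
  set δS : ℝ := min δ₀ δ₃ with hδS
  have hδS0 : 0 < δS := lt_min hδ₀ hδ₃
  refine ⟨max (Cs + Cs) (c₃ * θ⁻¹), δS, hδS0, fun k j => ?_⟩
  cases k with
  | zero =>
      -- k = 0: uniform bound on both members, θ^0 = 1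
      have h := locStencil_sub (hS (0 + j)) (hS 0)
      rw [pow_zero, mul_one]
      exact locStencil_mono' h (le_max_left _ _) (min_le_left _ _)
  | succ k =>
      -- k+1 ≥ 1: members (k+j+1, k+1), drift c₃ θ^k = (c₃ θ⁻¹) θ^(k+1)
      rw [show k + 1 + j = k + j + 1 by omega]
      have h := locStencil_unitS_Spure_succ_sub (d := d) (Lc := Lc) hE3d k j
      have hθk : c₃ * θ ^ k ≤ max (Cs + Cs) (c₃ * θ⁻¹) * θ ^ (k + 1) := by
        calc c₃ * θ ^ k = (c₃ * θ⁻¹) * θ ^ (k + 1) := by rw [pow_succ]; field_simp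
          _ ≤ max (Cs + Cs) (c₃ * θ⁻¹) * θ ^ (k + 1) :=
            mul_le_mul_of_nonneg_right (le_max_right _ _) (pow_nonneg hθ.le _)
      exact locStencil_mono' h hθk (min_le_right _ _)

end Generic

/-! ## §2 `d = 3`, `Lc ≥ 2`: «E3Shape» ∧ «E3Drift» and the `Spure` drift, UNCONDITIONAL from the twelve landed rows -/

section Three

variable {Lc : ℕ} [NeZero Lc]

/-- **«E3Shape» ∧ «E3Drift» ARE UNCONDITIONAL AT `d = 3`, `Lc ≥ 2`** (with rate data `0 < θ₃ < 1`, `0 < δ₃`): the normalised value-function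
third-jet summand of an2's step stencils is uniformly local along the tower AND drifts geometrically.  The twelve landed rows of road «S3» BY NAME,
merged by `StencilSlotRowsMerge.rows_merge`, into `StencilSlotE3Tables.e3Shape_and_drift_of_rows` — the composition of
`StencilSlotWallThree.d1Drift_JsBalOf_iff_three_of_diffRows` with `dW := TaylorRowDWThree.rowDW_three`, `dV := S3DiffV.diffV_three` (`0 ≤ cV` dropped),
`dL := S3DiffL.diffL_three`, exposed as a standalone statement. [folklore] composition. -/
theorem e3ShapeDrift_three (hLc : 2 ≤ Lc) (cE cVH cΛ : ℝ) :
    ∃ C₃ c₃ θ₃ δ₃ : ℝ, 0 < θ₃ ∧ θ₃ < 1 ∧ 0 < δ₃ ∧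
      (∀ j : ℕ, LocStencil (unitS (sfStep Lc (j + 1)) (smStep 3 Lc (j + 1))
        (fun κ u => (cE * wE 3 Lc (j + 1)) • e3Of 3 Lc cE cVH cΛ (j + 1) κ u)) C₃ δ₃) ∧
      (∀ k j : ℕ, LocStencil (fun κ u =>
          unitS (sfStep Lc (k + j + 1)) (smStep 3 Lc (k + j + 1))
              (fun κ u => (cE * wE 3 Lc (k + j + 1)) • e3Of 3 Lc cE cVH cΛ (k + j + 1) κ u) κ u -
            unitS (sfStep Lc (k + 1)) (smStep 3 Lc (k + 1))
              (fun κ u => (cE * wE 3 Lc (k + 1)) • e3Of 3 Lc cE cVH cΛ (k + 1) κ u) κ u) (c₃ * θ₃ ^ k) δ₃) := by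
  have hLc1 : 1 ≤ Lc := one_le_of_two_le hLc
  obtain ⟨hι0, hι1⟩ := inv_Lc_ratio (Lc := Lc) hLc
  obtain ⟨c₀V, δ₂, -, hδ₂, hV0⟩ := S3RowV0.shapeV0 (Lc := Lc) hLc1 cVH
  obtain ⟨c₀L, θ₃', δ₃', -, hθ₃0, hθ₃1', hδ₃', hL0⟩ := S3ShapeL0.rowL0_shape (Lc := Lc) hLc cΛ
  obtain ⟨cV, θ₆, δ₆, -, hθ₆0, hθ₆1, hδ₆, hV⟩ := TaylorRowV.rowV_three (Lc := Lc) hLc cVH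
  obtain ⟨cL, δ₇, hδ₇, hL⟩ := TaylorRowLam.rowL_three (Lc := Lc) cΛ
  obtain ⟨cLt, θ₁₀, -, hθ₁₀0, hθ₁₀1, dLt⟩ := S3DiffLt.diffLt_three (Lc := Lc) hLc cΛ
  obtain ⟨cV₁, θ₁₁, ρ₁₁, -, hθ₁₁0, hθ₁₁1, hρ₁₁0, hρ₁₁1, dV⟩ := S3DiffV.diffV_three (Lc := Lc) hLc cVH
  obtain ⟨δ, θ, ρ, CW, c₀V', c₀L', CtV, CtL, cV', cL', eW, eVt, eLt, eV, eL, hδ, hθ0, hθ1, hρ0, hρ1,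
      h₁, h₂, h₃, h₄, h₅, h₆, h₇, h₈, h₉, h₁₀, h₁₁, h₁₂⟩ :=
    rows_merge (d := 3) (TaylorRowW.rowW_three (Lc := Lc) cE) ⟨c₀V, (Lc : ℝ)⁻¹, δ₂, hδ₂, hι0, hι1, hV0⟩
      ⟨c₀L, θ₃', δ₃', hδ₃', hθ₃0, hθ₃1', hL0⟩ (S3ShapeVt.shapeVt_three (Lc := Lc) hLc1 cVH) (TaylorRowLamTop.rowLamTop (Lc := Lc) hLc1 cΛ)
      ⟨cV, θ₆, δ₆, hδ₆, hθ₆0, hθ₆1, hV⟩ ⟨cL, (Lc : ℝ)⁻¹, δ₇, hδ₇, hι0, hι1, hL⟩ (TaylorRowDWThree.rowDW_three (Lc := Lc) hLc cE)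
      (TopBorderKSlot.diffVt_three (Lc := Lc) hLc cVH) ⟨cLt, θ₁₀, hθ₁₀0, hθ₁₀1, dLt⟩ ⟨cV₁, θ₁₁, ρ₁₁, hθ₁₁0, hθ₁₁1, hρ₁₁0, hρ₁₁1, dV⟩
      (S3DiffL.diffL_three (Lc := Lc) hLc cΛ)
  obtain ⟨C₃, c₃, θ₃, δ₃, hθ₃, hθ₃1, hδ₃, hE3, hE3d⟩ :=
    e3Shape_and_drift_of_rows (d := 3) hLc1 cE cVH cΛ hδ hθ0 hθ1 hρ0 hρ1 h₁ h₂ h₃ h₄ h₅ h₆ h₇ h₈ h₉ h₁₀ h₁₁ h₁₂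
  exact ⟨C₃, c₃, θ₃, δ₃, hθ₃, hθ₃1, hδ₃, hE3, hE3d⟩

/-- **THE NORMALISED `Spure` FAMILY AT `d = 3`, `Lc ≥ 2`: UNIFORMLY LOCAL AND CAUCHY AT A GEOMETRIC RATE, UNCONDITIONAL** — both halves with ONE
rate `δS > 0` and ONE ratio `θ ∈ (0, 1)`: `(∀ j, LocStencil (unitS_j (Spure j)) Cs δS) ∧ (∀ k j, LocStencil (unitS_{k+j} (Spure (k+j)) − unitS_k (Spure k)) (cS·θ^k) δS)`.
`e3ShapeDrift_three` into leaf-07's `WSlotOfShapes.locStencil_unitS_Spure` and §1's `spureDrift_of_shapes`, rates merged at the minimum.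
[folklore] composition. -/
theorem spureShapeDrift_three (hLc : 2 ≤ Lc) (cE cVH cΛ : ℝ) :
    ∃ Cs cS θ δS : ℝ, 0 < θ ∧ θ < 1 ∧ 0 < δS ∧
      (∀ j, LocStencil (unitS (sfStep Lc j) (smStep 3 Lc j) (Spure 3 Lc cE cVH cΛ j)) Cs δS) ∧
      (∀ k j, LocStencil
        (unitS (sfStep Lc (k + j)) (smStep 3 Lc (k + j)) (Spure 3 Lc cE cVH cΛ (k + j)) -
          unitS (sfStep Lc k) (smStep 3 Lc k) (Spure 3 Lc cE cVH cΛ k)) (cS * θ ^ k) δS) := by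
  have hLc1 : 1 ≤ Lc := one_le_of_two_le hLc
  obtain ⟨C₃, c₃, θ₃, δ₃, hθ₃, hθ₃1, hδ₃, hE3, hE3d⟩ := e3ShapeDrift_three (Lc := Lc) hLc cE cVH cΛ
  obtain ⟨Cs, δs, hδs, hS⟩ := locStencil_unitS_Spure (d := 3) (Lc := Lc) hLc1 hE3 hδ₃
  obtain ⟨cS, δS, hδS, hD⟩ := spureDrift_of_shapes (d := 3) (Lc := Lc) hLc1 hθ₃ hE3 hE3d hδ₃
  have hCs : 0 ≤ Cs := ((hS 0) 0 0).nonneg (Sum.inl 0)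
  have hcS : 0 ≤ cS := by
    have h := ((hD 0 0) 0 0).nonneg (Sum.inl 0)
    simpa using h
  refine ⟨Cs, cS, θ₃, min δs δS, hθ₃, hθ₃1, lt_min hδs hδS, fun j => ?_, fun k j => ?_⟩
  · exact locStencil_mono' (hS j) le_rfl (min_le_left _ _)
  · exact locStencil_mono' (hD k j) le_rfl (min_le_right _ _)

/-- **THE `S`-ARGUMENT DATUM OF THE W-SLOT's CAUCHY HALF, `d = 3`, `Lc ≥ 2`, UNCONDITIONAL**: the normalised first field table of an2's
Lagrangian chart drifts geometrically along the tower —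
`∃ cS θ δS, 0 < θ ∧ θ < 1 ∧ 0 < δS ∧ ∀ k j, LocStencil (unitS_{k+j} (Spure 3 Lc cE cVH cΛ (k+j)) − unitS_k (Spure 3 Lc cE cVH cΛ k)) (cS·θ^k) δS`.
[folklore] the second half of `spureShapeDrift_three`. -/
theorem spureDrift_three (hLc : 2 ≤ Lc) (cE cVH cΛ : ℝ) :
    ∃ cS θ δS : ℝ, 0 < θ ∧ θ < 1 ∧ 0 < δS ∧ ∀ k j, LocStencil
      (unitS (sfStep Lc (k + j)) (smStep 3 Lc (k + j)) (Spure 3 Lc cE cVH cΛ (k + j)) -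
        unitS (sfStep Lc k) (smStep 3 Lc k) (Spure 3 Lc cE cVH cΛ k)) (cS * θ ^ k) δS := by
  obtain ⟨-, cS, θ, δS, hθ, hθ1, hδS, -, hD⟩ := spureShapeDrift_three (Lc := Lc) hLc cE cVH cΛ
  exact ⟨cS, θ, δS, hθ, hθ1, hδS, hD⟩

end Three

end Summit.QuantumFields.BalabanUV.Beta.GAN24.SpureUnitDrift

end
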